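import Summits.ResolutionOfSingularities.ResolutionOfSingularities.Theorems.FrobeniusClosingPatchingRelPerfectDepthSncLocusOpen
import Literature.AlgebraicGeometry.Resolution.MarkedIdealsEtale
import HarnessLib

/-!
# Crux `PatchingRelPerfect` (stmt-ResolutionOfSingularities-16161), chain W5.2 — F7(β) (β-AX) A1 bridge (c), corollary:
# `SNCWithAt` pulls back POINTWISE along étale morphisms, and the open SNC-with locus carries the GLOBAL predicate
# `HasSNCWith` on the open subscheme

[OURS · L1 W5.2 · rung tool; res-L1-w52-plan-1 RULING G11-17 (4) / NAMING 2026-08-27T16:26:25Z → res-D-pv-046 («+ corollary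
`exists_isOpen_hasSNC_comap`»)] Replaces the role of NO printed item of the manuscript under review; fact-free.

* `SNCWithAt.comap_of_etale` — the tree's `HasSNCWith.comap_of_etale` (`Literature/…/MarkedIdealsEtale.lean`, which reads its
  global hypothesis only at the image point) restated POINTWISE: `SNCWithAt E C (φ x') → SNCWithAt (φ^*E) (φ^*C) x'` for `φ` flat,
  unramified and locally of finite type (e.g. an open immersion); same proof.
* `exists_isOpen_hasSNCWith_comap` — on a Noetherian quasi-excellent scheme, if `SNCWithAt 𝓕 ⊤` holds at every point of `Z`,
  there is an open `U ⊇ Z` such that the restricted family `𝓕|_U` has simple normal crossings GLOBALLY on the open subscheme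
  `U` (`HasSNCWith (𝓕.map (·.comap U.ι)) ⊤`): `exists_isOpen_forall_sncWithAt'` + the pointwise pull-back along `U.ι`.

## References (for the mathematics; nothing here is a statement of the manuscript under review)
* E. Bierstone, D. Grigoriev, P. Milman, J. Włodarczyk, arXiv:1206.3090, Thm. 8.0.5 with Def. 3.1.1 / 3.1.3 (2).
  [BierstoneGrigorievMilmanWlodarczyk2011]
* H. Matsumura, *Commutative Ring Theory* (1986), Thm. 15.1. [Matsumura1987]
-/

-- `Summit.<Summit>.<Sub>.Theorems` with `Sub = Summit` (single-conjunct summit, D-0017)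
set_option linter.dupNamespace false

noncomputable section

open CategoryTheory AlgebraicGeometry TopologicalSpace IsLocalRing
open Literature.AlgebraicGeometry.Resolution

namespace Summit.ResolutionOfSingularities.ResolutionOfSingularities.Theorems

universe u

namespace DepthSNC

/-! ## §1 Pointwise étale pull-back of `SNCWithAt` -/

section Etale

variable {X' X : Scheme.{u}} (φ : X' ⟶ X) [Flat φ] [FormallyUnramified φ] [LocallyOfFiniteType φ]
  [IsLocallyNoetherian X]

/-- **`SNCWithAt` pulls back along étale morphisms, pointwise**: a regular system of parameters of `𝒪_{X, φ x'}` adapted to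
`E` and `C` maps to one of `𝒪_{X', x'}` adapted to `φ^*E` and `φ^*C` (`𝔪_{φ x'} 𝒪_{X',x'} = 𝔪_{x'}`, equal dimensions, stalks
of pulled-back ideal sheaves are extended stalks). The tree's `HasSNCWith.comap_of_etale`, read at one point.
[cite: BierstoneGrigorievMilmanWlodarczyk2011, Thm. 8.0.5 with Def. 3.1.3 (2)] -/
theorem SNCWithAt.comap_of_etale {E : List X.IdealSheafData} {C : X.IdealSheafData} {x' : X'}
    (h : SNCWithAt E C (φ x')) : SNCWithAt (E.map (·.comap φ)) (C.comap φ) x' := by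
  classical
  haveI : IsLocallyNoetherian X' := LocallyOfFiniteType.isLocallyNoetherian φ
  obtain ⟨hreg, d, u, hd, hu, ⟨ι, hι, hιD⟩, hC⟩ := h
  haveI := hreg
  haveI hreg' : IsRegularLocalRing (X'.presheaf.stalk x') := (isRegularLocalRing_stalk_iff_of_etale φ x').mpr hreg
  set f := (φ.stalkMap x').hom with hf
  -- the embedding dimensions agree
  have hrank : (maximalIdeal (X'.presheaf.stalk x')).spanFinrank = d := by
    have h1 := hreg'.spanFinrank_maximalIdeal
    have h2 := hreg.spanFinrank_maximalIdeal
    rw [ringKrullDim_stalk_eq_of_etale φ x', ← h2, hd] at h1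
    exact_mod_cast h1
  refine ⟨hreg', d, fun i => f (u i), hrank, ?_, ?_, ?_⟩
  · -- `(f ∘ u) = 𝔪_{x'}`
    rw [show (fun i => f (u i)) = f ∘ u from rfl, Set.range_comp, ← Ideal.map_span, hu, hf,
      map_stalkMap_maximalIdeal]
  · -- the boundary components through `x'`
    have key : ∀ D' : {D' // D' ∈ E.map (·.comap φ) ∧ x' ∈ D'.support},
        ∃ D : {D // D ∈ E ∧ φ x' ∈ D.support}, D.1.comap φ = D'.1 := by
      rintro ⟨D', hD'E, hx'⟩
      obtain ⟨D, hDE, rfl⟩ := List.mem_map.mp hD'E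
      refine ⟨⟨D, hDE, ?_⟩, rfl⟩
      rw [Scheme.IdealSheafData.support_comap] at hx'
      exact hx'
    choose g hg using key
    refine ⟨fun D' => ι (g D'), ?_, ?_⟩
    · intro D₁ D₂ heq
      have h2 : g D₁ = g D₂ := hι heq
      apply Subtype.ext
      rw [← hg D₁, ← hg D₂, h2]
    · intro D'
      rw [← hg D', stalkIdeal_comap_eq_map, hιD (g D'), Ideal.map_span, Set.image_singleton]
  · -- the centre
    intro hx'
    rw [Scheme.IdealSheafData.support_comap] at hx'
    obtain ⟨S, hS⟩ := hC hx'
    refine ⟨S, ?_⟩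
    rw [stalkIdeal_comap_eq_map, hS, Ideal.map_span, Set.image_image]

end Etale

/-! ## §2 The open SNC-with locus carries `HasSNCWith` on the open subscheme -/

section Global

variable {X : Scheme.{u}} [IsNoetherian X]

/-- **An open `U ⊇ Z` on which the restricted family has simple normal crossings** (the global predicate on the open
subscheme): from `exists_isOpen_forall_sncWithAt'` and the pointwise pull-back along the open immersion `U.ι`. [folklore] -/
theorem exists_isOpen_hasSNCWith_comap (hX : Scheme.IsQuasiExcellent X) (𝓕 : List X.IdealSheafData) {Z : Set X}
    (h : ∀ x ∈ Z, SNCWithAt 𝓕 ⊤ x) :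
    ∃ U : X.Opens, Z ⊆ (U : Set X) ∧ HasSNCWith (𝓕.map (·.comap U.ι)) ⊤ := by
  obtain ⟨U, hZU, hU⟩ := exists_isOpen_forall_sncWithAt' hX 𝓕 h
  refine ⟨U, hZU, hasSNCWith_of_forall_sncWithAt fun y => ?_⟩
  have hy : (U.ι y : X) ∈ (U : Set X) := by simp
  exact ((hU _ hy).comap_of_etale U.ι).top

end Global

end DepthSNC

end Summit.ResolutionOfSingularities.ResolutionOfSingularities.Theorems

end
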